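import Literature.NumberTheory.LFunctions.NymanBeurling
import Literature.NumberTheory.LFunctions.ZetaZeros
import Literature.NumberTheory.LFunctions.RHWave0
import HarnessLib

/-!
# Barrier: obstructions inside the Nyman–Beurling approach — the natural Möbius approximations diverge in `L²`, no fixed-coefficient series converges, and every approximation is slow (`≫ 1/√log N`) (Báez-Duarte 2000; Báez-Duarte–Balazard–Landreau–Saias 2000; Burnol 2002)

Barrier catalogue `Literature/Barriers/RiemannHypothesis/` (D-0021), entry
`NymanBeurlingObstructions` (namespace `Literature.Barriers.RiemannHypothesis`; the catalogued
declaration is `NymanBeurlingObstructions`, the conjunction of the three vendored no-go facts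
`BaezDuarte2000_prop4_4`, `BaezDuarte2000_prop4_7` and `BDBLS2000_uniform`; the `liminf` forms
`BDBLS2000_thm` (= Burnol's Thm. 1.2) and `Burnol2002_thm1_3` are vendored alongside).

Vocabulary follows the tree's `Literature.NumberTheory.LFunctions.baezDuarte_iff` (rh.S27,
`Literature/NumberTheory/LFunctions/RHClassicalEquivalents.lean`): `χ = 𝟙_{(0,1]}` (`nbChi`),
`ρ_a(x) = {1/(ax)}` (`beurlingRho a`), errors measured by `eLpNorm · 2 (volume.restrict (Ioi 0))`
(`l2Ioi`); `natError N c = ‖χ − ∑_{k<N} c_k ρ_{k+1}‖₂` is literally the quantity in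
`baezDuarte_iff` (`natError_eq`).

## The technique (Nyman 1950, Beurling 1955, Báez-Duarte 2003; the tree's route `RiemannHypothesis/NymanBeurling`)

Báez-Duarte 2003, Thm. 1.1 (the tree's `Literature.NumberTheory.LFunctions.baezDuarte_iff`, proved there as
`Literature.NumberTheory.LFunctions.baezDuarte_iff_holds`): RH holds iff `χ` lies in the `L²(0,∞)`-closure of the span of the
natural Beurling functions `ρ_a`, `a ∈ ℕ` (Nyman–Beurling: real dilations `a ≥ 1`). Báez-Duarte
2003, §1: "By necessity all authors have been led in one way or another to the natural approximation
`F_n := ∑_{a=1}^n μ(a)ρ_a`, which tends to `−χ` both a.e. and in `L₁` norm when restricted to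
`(0,1)` …, but which has been shown ([IUO], [AB]) to diverge in `𝓗`. … A common problem to these
sequences is that if they converge at all to `−χ` in `𝓗` they must do so very slowly: it is known
[BDBLS 2000] that for any `F = ∑_{k=1}^n c_k ρ_{a_k}`, `a_k ≥ 1`, if `N = max a_k`, then
`‖F − χ‖_𝓗 ≥ C/√(log N)` (3) for an absolute constant `C` that has recently been sharpened by
J. F. Burnol."

## The obstructions (what this file vendors)

* **Báez-Duarte 2000, Prop. 4.4** (with `S_n(x) := ∑_{k=1}^n μ(k)ρ(1/(kx))` (1.12), "perhaps the
  most natural", and `V_n := S_n − g(n)ρ(1/x)` (1.11), `g(n) = ∑_{k≤n} μ(k)/k`): "If there is some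
  zero of `ζ(s)` with real part `1/p` then `S_n` and `V_n` diverge in `L_p`. In particular `S_n` and
  `V_n` diverge in `L₂`." (§4: "not converging in `L_p` to the corresponding generator is equivalent
  to diverging in `L_p`", the a.e. limit being `−χ`.) Vendored for `S_n` in `L²` as
  `BaezDuarte2000_prop4_4`: `‖χ + S_n‖₂ ↛ 0`.
* **Báez-Duarte 2000, Prop. 4.5**: "There exists a constant `C > 0` such that
  `‖χ + S_n‖₂ ≥ max( (C/√n)|M(n) + 2|, |g(n)|√n )`" (`M` = Mertens function). Vendored as
  `BaezDuarte2000_prop4_5`.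
* **Báez-Duarte 2000, Prop. 4.7** (`𝒞^{nat}` = span of `e_k(x) := ρ(1/(kx)) − (1/k)ρ(1/x)`,
  `k ≥ 2`; a *series* is `f_n = ∑_{k=2}^n c_k e_k` with coefficients independent of `n`): "No series
  in `𝒞^{nat}` converges in `L_p(0,1)` to `−χ` if there is a zero of `ζ(s)` with real part `1/p`. In
  particular, no series in `𝒞^{nat}` converges to `−χ` in `L₂(0,1)`." Vendored (the `L²` clause) as
  `BaezDuarte2000_prop4_7`.
* **BDBLS 2000 / Burnol 2002.** With `𝓑_λ` the span of `t ↦ ρ(θ/t)`, `λ ≤ θ ≤ 1` (i.e. of `ρ_a`,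
  `1 ≤ a ≤ 1/λ`) and `D(λ) := inf_{f ∈ 𝓑_λ} ‖χ − f‖` (`nbDist λ`): **Thm. 1.2** (BDBLS):
  "`liminf_{λ→0} D(λ)√(log(1/λ)) ≥ √(∑_ρ 1/|ρ|²)`", the sum "over all non-trivial zeros `ρ` …
  counted only once independently of their multiplicities"; **Thm. 1.3** (Burnol):
  "`liminf_{λ→0} D(λ)√(log(1/λ)) ≥ √(∑_ρ m_ρ²/|ρ|²)`". ("If the Riemann Hypothesis fails this result
  is true but trivial as the left-hand side then takes the value `+∞`.") Vendored as `BDBLS2000_thm`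
  and `Burnol2002_thm1_3`; the uniform form (3) printed in Báez-Duarte 2003, §1, as
  `BDBLS2000_uniform`.
* PROVED consequences for the tree's route: the quantity in `Literature.NumberTheory.LFunctions.baezDuarte_iff` is
  `natError` (`natError_eq`, `rfl`); given `BDBLS2000_uniform`, every `ε`-approximation
  `natError N c < ε` needs `N > exp((C/ε)²)` (`exp_lt_of_natError_lt`), and
  `natError N c ≥ C/√(log N)` for all `N ≥ 2` (`natError_ge_of_uniform`).

## Status of the three conjuncts in the tree (2026-08-16)

All three conjuncts, Prop. 4.5 and Burnol's Thm. 1.3 are now THEOREMS of the tree, not vendored facts: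
`BaezDuarte2000_prop4_4_holds` and `BDBLS2000_thm_holds` (`NymanBeurlingObstructionsProofs.lean`),
`BaezDuarte2000_prop4_7_holds` (`NymanBeurlingObstructionsSeriesProofs.lean`),
`BDBLS2000_uniform_holds` (`NymanBeurlingObstructionsBDBLSProofs.lean`, from one zero `½ + iγ`
on the line), `BaezDuarte2000_prop4_5_holds` (`NymanBeurlingObstructionsProp45Proofs.lean`,
`C = 1/√32`), `Burnol2002_thm1_3_holds` (`NymanBeurlingObstructionsBurnolProofs.lean`), assembled as
`NymanBeurlingObstructions_holds` (`NymanBeurlingObstructionsAssembly.lean`).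

## Audit (barrier-audit, gen 1, 2026-08-16): CONFIRMED — with the exact reach of the three claims

The audit re-read the sources at page level (Báez-Duarte 2000 §1 pp. 2–5 and §4 pp. 10–12;
Burnol 2002 §§1–5; Báez-Duarte 2003 §1) and searched the later literature (list below). The
vendored statements are the printed ones (setting `L_p(0,∞)` with `L_p(0,1)` embedded, Báez-Duarte
2000 §1.1; `K = L²(]0,∞[,dt)`, `𝓑_λ`, `D(λ)`, Burnol 2002 §1), and all are proved in the tree. What
the barrier does NOT say — recorded here so that routes are matched against (a)–(c) and not
against the `technique_class` tokens alone:

1. **(a), (b) are statements about ONE coefficient choice and about ORDINARY partial sums.** They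
   exclude `S_n`, `V_n` (and, printed but not vendored, `B_n`, `F_n`, `G_n`, `R_n`) and series
   `∑_{k ≤ n} c_k e_k` with `c_k` independent of `n`. They do not touch `n`-dependent reweightings
   of the same Möbius data, i.e. summability methods applied to the natural series: Abel weights
   `μ(a)a^{−ε}` (Báez-Duarte 2003, Thm. 1.1: convergence under RH, the tree's
   `baezDuarte_iff_holds`) and Riesz logarithmic weights
   `V_N(s) = ∑_{n ≤ N}(1 − log n/log N)μ(n)n^{−s}`: Bettin–Conrey–Farmer 2013, Thm. 1 — under RH and
   `∑_{|Im ρ| ≤ T} |ζ'(ρ)|^{−2} ≪ T^{3/2−δ}`, `(1/2π)∫|1 − ζV_N(½+it)|² dt/(¼+t²) ∼ (2+γ−log 4π)/log N`,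
   i.e. this explicit smoothed truncation attains Burnol's lower bound. Nor do they exclude a
   convergent SUBSEQUENCE of `S_n` (Báez-Duarte 2000, Remarks 4.2, 4.4, 4.6: "this subsequence is
   still a candidate"; only (c) applies to it, forcing `‖χ + S_{n_j}‖₂ ≥ C/√(log n_j)`); numerically
   the local minima of `‖∑_{k≤n} μ(k)G_k − E‖²_{H²(ℂ_{1/2})}` stay near `4·10⁻²` up to `n = 10⁵`
   (Manzur–Noor–Quintero 2026, §4). Vasyunin's "corrections" (natural step functions equal to `1`
   on `[1, n+1)`) are `n`-dependent and outside (b); only the first one is proved divergent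
   (Báez-Duarte 2005, Thm. 2.1, in `L¹((0,∞), x⁻²dx)`), the seeds `g_n`, `h_n` are open (ibid., §2).
2. **(c) is a statement in the LARGEST DILATION only.** `BDBLS2000_uniform` bounds
   `‖χ − ∑ c_j ρ_{a_j}‖₂` below by `C/√(log N)` when `1 ≤ a_j ≤ N`; it yields no lower bound in the
   number of terms, in the size of the coefficients, or for approximants whose dilation set is
   unbounded (`f_ε = ∑_{a ≥ 1} μ(a)a^{−ε}ρ_a`, continuous superpositions `∫_0^1 ρ(θ/t)g(θ)dθ/θ` with
   `g` not vanishing near `0`), for which `N = ∞` and (c) is void. It constrains the RATE, never the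
   existence, of approximations: it bears on numerical certification and on any claimed rate
   `o(1/√log N)`, not on a proof that `d_N → 0`. Under RH the rate is nearly attained:
   `d_N² ≪_δ (log log N)^{5/2+δ}(log N)^{−1/2}` (Balazard–de Roton 2010, Thm. 1) and, conditionally
   as in item 1, `d_N² ∼ (∑_ρ m_ρ²/|ρ|²)/log N` (Bettin–Conrey–Farmer 2013). The constant of
   `BDBLS2000_uniform_holds` is inexplicit (one zero); the asymptotic constant is
   `√(∑_ρ m_ρ²/|ρ|²)`, `= √(2+γ−log 4π) ≈ 0.215` under RH with simple zeros.
3. **Weaker norms are untouched.** (a) is the `p = 2` clause; for `1 < p < 2` (equivalently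
   `H²(ℂ_α)`, `α > 1/2`) divergence of `S_n` is proved only if a zero with `Re s = 1/p` exists
   (Báez-Duarte 2000, Prop. 4.4), while convergence of the natural series in `H²(ℂ_α)` would give the
   zero-free half-plane `ℂ_α` (Manzur–Noor–Quintero 2026, Prop. 3.1; proved for `α > 1`, Thm. 3.1;
   Noor 2019 for the `H²(𝔻)` reformulation, where `∑_k (μ(k)/k)(I − S)h_k → 1 − z` unconditionally,
   Lemma 11; Ghosh–Kremnitzer–Noor–Santos, Adv. Math. 455 (2024), for zero-free half-planes via spaces
   of analytic functions). Partial approximation is not worthless either: a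
   distance `d > 0` certifies an explicit zero-free region (Nikolski 1995; Delaunay–Fricain–Mosaki–
   Robert 2013, Thm. 2.1), so (c) prices zero-free regions obtained with dilations `≤ N`, it does not
   forbid them.
4. **Generalised criteria.** With random or convolved dilations confined to `(0,1]` the BDBLS bound
   persists (`𝒟_n² ≫ 1/(log 2 + |log 𝔼 m_n|)`, Darses–Hillion 2021, Lemma 1); families whose dilation
   law charges `(1,∞)` approximate `χ` unconditionally (Wiener: `𝓐 = 𝓐_{(0,∞)}` is dense in
   `L²(0,∞)`, Báez-Duarte 2000 §1.2; Alouges–Darses–Hillion 2023) and RH moves into a coefficient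
   condition (Darses–Hillion 2021, §4; Alouges–Darses–Hillion 2023, Thm. 2 with condition (C)) — outside this barrier's hypotheses
   (`1 ≤ a_j`).

No counterexample or contradicting result was found; the `liminf` constant and the `1/√log N` law
are restated as such in Balazard–de Roton 2010 §1, Bettin–Conrey–Farmer 2013 §1 and
Darses–Hillion 2021 §1.2.

## References

* [BaezDuarte2000] L. Báez-Duarte, *Arithmetical aspects of Beurling's real variable reformulation
  of the Riemann hypothesis*, arXiv:math/0011254 (2000) (read: §1 pp. 2–5, §4 pp. 10–12 with
  Props. 4.1–4.7).
* [BaezDuarte2003] L. Báez-Duarte, *A strengthening of the Nyman–Beurling criterion for the Riemann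
  hypothesis*, Rend. Lincei (9) 14 (2003), 5–11; arXiv:math/0202141 (read: §1 p. 3, eqs. (1.2)–(1.3)).
* [Burnol2002] J.-F. Burnol, *A lower bound in an approximation problem involving the zeros of the
  Riemann zeta function*, Adv. Math. 170 (2002), 56–70; arXiv:math/0103058 (read: §1 p. 2,
  Thms. 1.1–1.4).
* [BDBLS2000] L. Báez-Duarte, M. Balazard, B. Landreau, E. Saias, *Notes sur la fonction ζ de
  Riemann, 3*, Adv. Math. 149 (2000), 130–144 (not held; cited through Burnol Thm. 1.2 and
  Báez-Duarte 2003 §1 (1.3)).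
* [IUO] L. Báez-Duarte, *A class of invariant unitary operators*, Adv. Math. 144 (1999), 1–12 (first
  proof of the `L²` divergence; as cited in Báez-Duarte 2000/2003, not read).
* [BettinConreyFarmer2013] S. Bettin, J. B. Conrey, D. W. Farmer, *An optimal choice of Dirichlet
  polynomials for the Nyman–Beurling criterion*, Proc. Steklov Inst. Math. 280 (2013);
  arXiv:1211.5191 (read in full: Thm. 1, Lemmas 2–3).
* [BalazardDeRoton2010] M. Balazard, A. de Roton, *Sur un critère de Báez-Duarte pour l'hypothèse de
  Riemann*, Int. J. Number Theory 6 (2010), 883–903; arXiv:0812.1689 (read: §1, Thm. 1).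
* [BaezDuarte2005Vasyunin] L. Báez-Duarte, *A divergent Vasyunin correction*, arXiv:math/0506318
  (2005) (read in full: Thm. 2.1, Thm. 3.1, §2 on the seeds `g_n`, `h_n`).
* [ManzurNoorQuintero2026] J. Manzur, W. Noor, G. Quintero, *A Hardy space approximation supporting
  zero-free half-planes for the ζ-function*, arXiv:2606.16097 (2026) (read: §1, Thm. 3.1, Prop. 3.1,
  §4).
* [Noor2019] S. W. Noor, *A Hardy space analysis of the Báez-Duarte criterion for the RH*, Adv. Math.
  350 (2019), 242–255; arXiv:1809.09577 (read: abstract, Thm. 6 as quoted in ManzurNoorQuintero2026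
  Thm. 2.1).
* [Nikolski1995] N. Nikolski, *Distance formulae and invariant subspaces, with an application to
  localization of zeros of the Riemann ζ-function*, Ann. Inst. Fourier 45 (1995), 143–159 (through
  DelaunayFricainMosakiRobert2013, §1 (1.2)).
* [DelaunayFricainMosakiRobert2013] C. Delaunay, E. Fricain, E. Mosaki, O. Robert, *Zero free regions
  for Dirichlet series*, Trans. Amer. Math. Soc. 365 (2013), 3227–3253; arXiv:1101.1199 (read: §1,
  Thm. 2.1).
* [DarsesHillion2021] S. Darses, E. Hillion, *On probabilistic generalizations of the Nyman–Beurling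
  criterion for the zeta function*, Confluentes Math. 13 (2021), 43–59; arXiv:1805.06733 (read: §1,
  §2.2.1 Lemma 1, Thm. 5).
* [AlougesDarsesHillion2023] F. Alouges, S. Darses, E. Hillion, *Polynomial approximations in a
  generalized Nyman–Beurling criterion*, J. Théor. Nombres Bordeaux 34 (2022), 767–785;
  arXiv:2006.02953 (read: §1, Thm. 2, Def. 1).
-/

noncomputable section

open MeasureTheory Filter Topology Set

namespace Literature.Barriers.RiemannHypothesis

/-! ## Vocabulary (as in `Literature.NumberTheory.LFunctions.baezDuarte_iff`) -/

/-- `χ = 𝟙_{(0,1]}`. [cite: BaezDuarte2003, §1] -/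
def nbChi (x : ℝ) : ℝ :=
  (Set.Ioc (0 : ℝ) 1).indicator 1 x

/-- The Beurling function `ρ_a(x) = {1/(ax)}` (`{·}` the fractional part; `a ≥ 1` real, `a ∈ ℕ` for
the natural ones; Beurling's `ρ(θ/x)` is `ρ_{1/θ}`). [cite: BaezDuarte2003, §1] -/
def beurlingRho (a x : ℝ) : ℝ :=
  Int.fract (1 / (a * x))

/-- The `L²((0,∞), dx)` seminorm, `ℝ≥0∞`-valued (`eLpNorm · 2 (volume.restrict (Ioi 0))`, as in
`Literature.NumberTheory.LFunctions.baezDuarte_iff`). [folklore] -/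
def l2Ioi (f : ℝ → ℝ) : ENNReal :=
  eLpNorm f 2 (volume.restrict (Set.Ioi 0))

/-- The error of a general Beurling combination with real dilations:
`‖χ − ∑_j c_j ρ_{a_j}‖_{L²(0,∞)}`. [cite: BaezDuarte2003, §1 (1.3)] -/
def genError {n : ℕ} (a c : Fin n → ℝ) : ENNReal :=
  l2Ioi fun x ↦ nbChi x - ∑ j, c j * beurlingRho (a j) x

/-- The error of a natural (integer-dilation) combination, `‖χ − ∑_{k<N} c_k ρ_{k+1}‖_{L²(0,∞)}` —
the quantity in `Literature.NumberTheory.LFunctions.baezDuarte_iff` (`natError_eq`). [cite: BaezDuarte2003, Thm. 1.1] -/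
def natError (N : ℕ) (c : Fin N → ℝ) : ENNReal :=
  genError (fun k : Fin N ↦ ((k : ℕ) : ℝ) + 1) c

/-- `natError` is literally the `eLpNorm` expression of `Literature.NumberTheory.LFunctions.baezDuarte_iff`. [cite: BaezDuarte2003, Thm. 1.1] -/
theorem natError_eq (N : ℕ) (c : Fin N → ℝ) :
    natError N c = eLpNorm (fun x : ℝ ↦ (Set.Ioc (0 : ℝ) 1).indicator 1 x -
        ∑ k : Fin N, c k * Int.fract (1 / (((k : ℕ) + 1 : ℝ) * x))) 2
      (volume.restrict (Set.Ioi 0)) :=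
  rfl

/-- Burnol's `D(λ) = inf_{f ∈ 𝓑_λ} ‖χ − f‖`, `𝓑_λ` the span of `t ↦ ρ(θ/t)`, `λ ≤ θ ≤ 1`, i.e. of the
`ρ_a` with `1 ≤ a ≤ 1/λ` (real coefficients suffice: all functions are real-valued). [cite: Burnol2002, §1 (Thm. 1.2)] -/
def nbDist (lam : ℝ) : ENNReal :=
  ⨅ (n : ℕ) (a : Fin n → ℝ) (_ : ∀ j, 1 ≤ a j ∧ a j ≤ 1 / lam) (c : Fin n → ℝ), genError a c

/-- `g(n) = ∑_{k ≤ n} μ(k)/k`. [cite: BaezDuarte2000, §1.1] -/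
def moebiusHarmonic (n : ℕ) : ℝ :=
  ∑ k ∈ Finset.Icc 1 n, (ArithmeticFunction.moebius k : ℝ) / k

/-- The coefficients of the natural approximation `S_n = ∑_{k ≤ n} μ(k) ρ_k` of `−χ`, written as an
approximation `∑ c_k ρ_{k+1}` of `+χ`: `c_k = −μ(k+1)`, so that `χ − ∑ c_k ρ_{k+1} = χ + S_n`.
[cite: BaezDuarte2000, §1.2 (1.12)] -/
def naturalCoeff (n : ℕ) : Fin n → ℝ :=
  fun k ↦ -(ArithmeticFunction.moebius ((k : ℕ) + 1) : ℝ)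

/-- `‖χ + S_n‖_{L²(0,∞)}`. [cite: BaezDuarte2000, §1.2 (1.12)] -/
def naturalError (n : ℕ) : ENNReal :=
  natError n (naturalCoeff n)

/-- Báez-Duarte's `e_k(x) = ρ(1/(kx)) − (1/k)ρ(1/x)`, `k ≥ 2`, spanning `𝒞^{nat}`.
[cite: BaezDuarte2000, §4.2 (4.11)] -/
def beurlingE (k : ℕ) (x : ℝ) : ℝ :=
  beurlingRho k x - (1 / (k : ℝ)) * beurlingRho 1 x

/-- The partial sums `f_n = ∑_{k=2}^n c_k e_k` of a *series* in `𝒞^{nat}` (coefficients independent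
of `n`). [cite: BaezDuarte2000, §4.2 (4.12)] -/
def natSeriesPartial (c : ℕ → ℝ) (n : ℕ) (x : ℝ) : ℝ :=
  ∑ k ∈ Finset.Icc 2 n, c k * beurlingE k x

/-! ## Vendored facts -/

/-- **Báez-Duarte 2000, Proposition 4.4** (`L²` clause for `S_n`): "`S_n` and `V_n` diverge in
`L₂`" — with the a.e. limit `−χ`, equivalently `‖χ + S_n‖₂ ↛ 0` (§4, first paragraph). First proved
in [IUO] (Báez-Duarte 1999). [cite: BaezDuarte2000, Prop. 4.4] -/
def BaezDuarte2000_prop4_4 : Prop :=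
  ¬ Tendsto naturalError atTop (𝓝 0)

/-- **Báez-Duarte 2000, Proposition 4.5**: "There exists a constant `C > 0` such that
`‖χ + S_n‖₂ ≥ max( C n^{−1/2} |M(n) + 2|, |g(n)| √n )`" (`M(n) = ∑_{k≤n} μ(k)` the Mertens
function, the tree's `Literature.NumberTheory.LFunctions.mertensFunction`). [cite: BaezDuarte2000, Prop. 4.5] -/
def BaezDuarte2000_prop4_5 : Prop :=
  ∃ C : ℝ, 0 < C ∧ ∀ n : ℕ, 1 ≤ n →
    ENNReal.ofReal (max (C / Real.sqrt n * |(Literature.NumberTheory.LFunctions.mertensFunction n : ℝ) + 2|)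
        (|moebiusHarmonic n| * Real.sqrt n)) ≤ naturalError n

/-- **Báez-Duarte 2000, Proposition 4.7** (`L²` clause): "no series in `𝒞^{nat}` converges to
`−χ` in `L₂(0,1)`": for no fixed coefficient sequence `(c_k)_{k ≥ 2}` do the partial sums
`f_n = ∑_{k=2}^n c_k e_k` satisfy `‖χ + f_n‖_{L²(0,1)} → 0`. [cite: BaezDuarte2000, Prop. 4.7] -/
def BaezDuarte2000_prop4_7 : Prop :=
  ∀ c : ℕ → ℝ, ¬ Tendsto
    (fun n ↦ eLpNorm (fun x ↦ nbChi x + natSeriesPartial c n x) 2 (volume.restrict (Set.Ioo 0 1)))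
    atTop (𝓝 0)

/-- `∑_ρ 1/|ρ|²` over the distinct nontrivial zeros (BDBLS's constant; `tsum`, junk `0` if the
family were not summable, which only weakens the bound). [cite: Burnol2002, Thm. 1.2] -/
def zeroSumInvNormSq : ℝ :=
  ∑' ρ : Literature.NumberTheory.LFunctions.ZetaZeros.riemannZetaNontrivialZeros, 1 / ‖(ρ : ℂ)‖ ^ 2

/-- `∑_ρ m_ρ²/|ρ|²`, zeros weighted by the square of their multiplicity
`m_ρ = Literature.riemannZetaZeroOrder ρ` (Burnol's constant). [cite: Burnol2002, Thm. 1.3] -/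
def zeroSumMultSqInvNormSq : ℝ :=
  ∑' ρ : Literature.NumberTheory.LFunctions.ZetaZeros.riemannZetaNontrivialZeros, (Literature.NumberTheory.LFunctions.riemannZetaZeroOrder (ρ : ℂ) : ℝ) ^ 2 / ‖(ρ : ℂ)‖ ^ 2

/-- **BDBLS 2000 (as printed in Burnol 2002, Theorem 1.2).** "`liminf_{λ→0} D(λ)√(log(1/λ)) ≥
√(∑_ρ 1/|ρ|²)`", stated as: for every `ε > 0`, `D(λ) ≥ (√S − ε)/√(log(1/λ))` for all small
`λ > 0`. [cite: Burnol2002, Thm. 1.2] [cite: BDBLS2000, main theorem] -/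
def BDBLS2000_thm : Prop :=
  ∀ ε : ℝ, 0 < ε → ∀ᶠ lam in 𝓝[>] (0 : ℝ),
    ENNReal.ofReal ((Real.sqrt zeroSumInvNormSq - ε) / Real.sqrt (Real.log (1 / lam))) ≤ nbDist lam

/-- **Burnol 2002, Theorem 1.3.** "`liminf_{λ→0} D(λ)√(log(1/λ)) ≥ √(∑_ρ m_ρ²/|ρ|²)`. So the zeros
are counted according to the square of their multiplicities." [cite: Burnol2002, Thm. 1.3] -/
def Burnol2002_thm1_3 : Prop :=
  ∀ ε : ℝ, 0 < ε → ∀ᶠ lam in 𝓝[>] (0 : ℝ),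
    ENNReal.ofReal ((Real.sqrt zeroSumMultSqInvNormSq - ε) / Real.sqrt (Real.log (1 / lam))) ≤
      nbDist lam

/-- **The uniform lower bound** (BDBLS 2000, as printed in Báez-Duarte 2003, §1, (1.3)): "for any
`F = ∑_{k=1}^n c_k ρ_{a_k}`, `a_k ≥ 1`, if `N = max a_k`, then `‖F − χ‖_𝓗 ≥ C/√(log N)`, for an
absolute constant `C`". Stated for any bound `N ≥ 2` of the dilations (equivalent, the right side
being decreasing in `N`; `N = 1` is excluded as `log 1 = 0`). [cite: BaezDuarte2003, §1 (1.3)] [cite: BDBLS2000, main theorem] -/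
def BDBLS2000_uniform : Prop :=
  ∃ C : ℝ, 0 < C ∧ ∀ (n : ℕ) (a c : Fin n → ℝ) (N : ℝ),
    (∀ j, 1 ≤ a j ∧ a j ≤ N) → 2 ≤ N →
      ENNReal.ofReal (C / Real.sqrt (Real.log N)) ≤ genError a c

/-! ## Proved consequences for the tree's route `Literature.NumberTheory.LFunctions.baezDuarte_iff` -/

/-- The natural (integer) dilations `k + 1`, `k < N`, are admissible with bound `N`.
[folklore] -/
theorem natDilation_bounds (N : ℕ) (k : Fin N) :
    1 ≤ ((k : ℕ) : ℝ) + 1 ∧ ((k : ℕ) : ℝ) + 1 ≤ N := by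
  refine ⟨by simp, ?_⟩
  have : (k : ℕ) + 1 ≤ N := k.isLt
  exact_mod_cast this

/-- From the uniform bound: every natural approximation with `N ≥ 2` terms misses `χ` by at least
`C/√(log N)` in `L²(0,∞)`. [cite: BaezDuarte2003, §1 (1.3)] -/
theorem natError_ge_of_uniform (h : BDBLS2000_uniform) :
    ∃ C : ℝ, 0 < C ∧ ∀ (N : ℕ) (c : Fin N → ℝ), 2 ≤ N →
      ENNReal.ofReal (C / Real.sqrt (Real.log N)) ≤ natError N c := by
  obtain ⟨C, hC, h⟩ := h
  refine ⟨C, hC, fun N c hN ↦ ?_⟩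
  exact h N (fun k : Fin N ↦ ((k : ℕ) : ℝ) + 1) c N (natDilation_bounds N) (by exact_mod_cast hN)

/-- **Cost of the route.** Given the uniform bound with constant `C`: if a natural combination with
`N ≥ 2` terms achieves `‖χ − ∑_{k<N} c_k ρ_{k+1}‖₂ < ε` (the `ε`-clause of `Literature.NumberTheory.LFunctions.baezDuarte_iff`),
then `C/√(log N) < ε`, i.e. `N > exp((C/ε)²)`. [cite: BaezDuarte2003, §1 (1.3)] -/
theorem exp_lt_of_natError_lt {C : ℝ} (hC : 0 < C)
    (h : ∀ (N : ℕ) (c : Fin N → ℝ), 2 ≤ N → ENNReal.ofReal (C / Real.sqrt (Real.log N)) ≤ natError N c)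
    {ε : ℝ} (hε : 0 < ε) {N : ℕ} (hN : 2 ≤ N) {c : Fin N → ℝ}
    (happrox : natError N c < ENNReal.ofReal ε) : Real.exp ((C / ε) ^ 2) < N := by
  have hlogpos : 0 < Real.log N := Real.log_pos (by exact_mod_cast hN)
  have hsqrt : 0 < Real.sqrt (Real.log N) := Real.sqrt_pos.2 hlogpos
  have h1 : ENNReal.ofReal (C / Real.sqrt (Real.log N)) < ENNReal.ofReal ε :=
    lt_of_le_of_lt (h N c hN) happrox
  rw [ENNReal.ofReal_lt_ofReal_iff hε] at h1
  -- `C / √(log N) < ε` ⇒ `C / ε < √(log N)` ⇒ `(C/ε)² < log N`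
  have h2 : C / ε < Real.sqrt (Real.log N) := by
    rw [div_lt_iff₀ hε]
    rw [div_lt_iff₀ hsqrt] at h1
    linarith [mul_comm ε (Real.sqrt (Real.log N))]
  have h3 : (C / ε) ^ 2 < Real.log N := by
    have hce : 0 < C / ε := div_pos hC hε
    calc (C / ε) ^ 2 < Real.sqrt (Real.log N) ^ 2 := by gcongr
      _ = Real.log N := Real.sq_sqrt hlogpos.le
  calc Real.exp ((C / ε) ^ 2) < Real.exp (Real.log N) := Real.exp_lt_exp.2 h3
    _ = N := Real.exp_log (by exact_mod_cast (lt_of_lt_of_le (by norm_num) hN))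

/-! ## The barrier -/

/-- **Barrier `NymanBeurlingObstructions` (Báez-Duarte 2000, Props. 4.4 and 4.7; BDBLS 2000 as
printed in Báez-Duarte 2003, §1, (1.3)).** Inside the Nyman–Beurling–Báez-Duarte criterion
(`Literature.NumberTheory.LFunctions.baezDuarte_iff`): (a) the natural Möbius approximation `S_n = ∑_{k≤n} μ(k)ρ_k` does not
converge to `−χ` in `L²(0,∞)`; (b) no series `∑_{k≥2} c_k e_k` with fixed coefficients converges to
`−χ` in `L²(0,1)`; (c) any combination of `ρ_a`'s with dilations `a ≤ N` misses `χ` by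
`≥ C/√(log N)`.

BARRIER (structured block, D-0021):
- technique_class: Nyman-Beurling Baez-Duarte-criterion Beurling-functions fractional-part-dilations natural-approximation Moebius-truncation fixed-coefficient-series L2-closure-distance Dirichlet-polynomial-approximation d_N-rate
- blocks: within the route `Literature.NumberTheory.LFunctions.baezDuarte_iff` / `Literature.NumberTheory.LFunctions.baezDuarte_dirichlet_iff` (RH ⇔ `χ ∈` closure of span{`ρ_a` : `a ∈ ℕ`}): proving RH by exhibiting the convergence of the natural approximation `S_n = ∑_{k≤n} μ(k)ρ_k` (or `V_n`, `B_n`, `F_n`, `G_n`) in `L²` [cite: BaezDuarte2000, Props. 4.1, 4.4, 4.6], or of any fixed-coefficient series in the `e_k` [cite: BaezDuarte2000, Prop. 4.7]; and any scheme needing `‖χ − F‖₂ = o(1/√(log N))` for dilations `≤ N`, in particular numerical evidence of convergence at a faster rate [cite: BaezDuarte2003, §1 (1.3)] [cite: Burnol2002, Thms. 1.2–1.3]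
- because: `‖χ + S_n‖₂ ≥ max(C|M(n)+2|/√n, |g(n)|√n)` via the invariant unitary operator `U` (`US_n = M(n)` on `(0,1/n)`) and `g(n) ≠ o(n^{−1/2})`, which holds because `ζ` has zeros on `Re s = 1/2` [cite: BaezDuarte2000, Prop. 4.5 and Cor. 2.1]; a convergent series would have `c_k = μ(k)` (pointwise limits on `(1/(j+1), 1/j]`) and thus be `V_n` [cite: BaezDuarte2000, Lemma 4.2 and Prop. 4.7]; the rate bound comes from Hilbert-space vectors attached to each zero `ρ` (with multiplicity, Burnol) controlling `D(λ)` [cite: Burnol2002, §1 and Thm. 1.3]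
- evasions_known: convergence IS restored by `n`-dependent reweighting: under RH `f_ε = ∑_a μ(a)a^{−ε}ρ_a ∈ closure(𝓑^{nat})` and `f_ε → −χ`, giving RH ⇔ `χ ∈ closure(𝓑^{nat})` [cite: BaezDuarte2003, Thm. 1.1 and §3] (the tree's `Literature.NumberTheory.LFunctions.baezDuarte_iff_holds`); subsequences along zero-crossings of `g(n)` or `M(n) = −2` are not excluded by Prop. 4.5 [cite: BaezDuarte2000, Remarks 4.2, 4.4, 4.6]; the rate `1/√(log N)` is conjecturally sharp (toy model Thm. 1.4/2.1) [cite: Burnol2002, Thms. 1.4 and 2.1]; Riesz-smoothed Möbius truncation `∑_{n≤N}(1 − log n/log N)μ(n)ρ_n` (an `n`-dependent reweighting, outside (a)/(b)) attains the rate `(2+γ−log 4π)/log N` under RH + `∑_{|Im ρ|≤T}|ζ'(ρ)|⁻² ≪ T^{3/2−δ}` [cite: BettinConreyFarmer2013, Thm. 1], and under RH alone `d_N² ≪_δ (log log N)^{5/2+δ}/√(log N)` [cite: BalazardDeRoton2010, Thm. 1]; Vasyunin's `n`-dependent corrections are outside (b) — only the first is proved divergent [cite: BaezDuarte2005Vasyunin,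 Thm. 2.1]; weaker norms (`L_p`, `p < 2`; `H²(ℂ_α)`, `α > 1/2`) are untouched by (a) and convergence there gives zero-free half-planes [cite: ManzurNoorQuintero2026, Prop. 3.1 and Thm. 3.1] [cite: Noor2019, Thm. 6]; a positive distance still certifies explicit zero-free regions, which (c) prices but does not forbid [cite: Nikolski1995, main theorem] [cite: DelaunayFricainMosakiRobert2013, Thm. 2.1]; randomised dilations in `(0,1]` keep the BDBLS bound [cite: DarsesHillion2021, Lemma 1], dilation laws charging `(1,∞)` approximate unconditionally and move RH into a coefficient condition [cite: AlougesDarsesHillion2023, Thm. 2]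
- status: established — all three conjuncts (and Prop. 4.5, Burnol Thm. 1.3) kernel-proved in the tree (`NymanBeurlingObstructions_holds`); audit gen 1 (2026-08-16): confirmed, no contradicting literature
- scope_caveats: (a) is the `L²` (`p = 2`) clause only — for `1 < p < 2` divergence in `L_p` is proved only when a zero with `Re s = 1/p` exists [cite: BaezDuarte2000, Props. 4.1, 4.4]; `B_n`, `F_n`, `G_n`, `R_n` (Props. 4.1, 4.3, 4.6) and `V_n` are not vendored; (b) concerns series with coefficients independent of `n` only; (c) is vendored in the uniform form printed in Báez-Duarte 2003 (1.3) (BDBLS's own text not held) and bounds the rate, not the possibility, of approximation; the `liminf` constants `∑ 1/|ρ|²`, `∑ m_ρ²/|ρ|²` are `tsum`s (junk `0` if non-summable, which only weakens them); (c) is a bound in the largest dilation `N` only — nothing follows about the number of terms or the coefficients, and approximants with unbounded dilation set (`f_ε`, `∫_0^1 ρ(θ/t)g(θ)dθ/θ`) are outside it; its constant `C` is inexplicit (asymptotically `√(∑ m_ρ²/|ρ|²) ≈ 0.215` under RH with simple zeros); the `technique_class` tokens `Nyman-Beurling`, `L2-closure-distance`, `Dirichlet-polynomial-approximation`, `d_N-rate`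 bite only through (a)–(c): a Nyman–Beurling route with `n`-dependent coefficients and no rate claim `o(1/√log N)` is not blocked (see the module docstring, §Audit)

[cite: BaezDuarte2000, Props. 4.4, 4.5, 4.7] [cite: BaezDuarte2003, §1 (1.3)] [cite: Burnol2002, Thms. 1.2–1.3] -/
def NymanBeurlingObstructions : Prop :=
  BaezDuarte2000_prop4_4 ∧ BaezDuarte2000_prop4_7 ∧ BDBLS2000_uniform

/-- The barrier from the three vendored facts. [cite: BaezDuarte2000, Props. 4.4 and 4.7] -/
theorem NymanBeurlingObstructions_of (h4 : BaezDuarte2000_prop4_4) (h7 : BaezDuarte2000_prop4_7)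
    (hu : BDBLS2000_uniform) : NymanBeurlingObstructions :=
  ⟨h4, h7, hu⟩

/-- With the barrier, the `ε`-clause of `Literature.NumberTheory.LFunctions.baezDuarte_iff` can only be met with
`N > exp((C/ε)²)` terms (`C` the BDBLS constant), for every `ε > 0`. [cite: BaezDuarte2003, §1 (1.3)] -/
theorem NymanBeurlingObstructions.cost (h : NymanBeurlingObstructions) :
    ∃ C : ℝ, 0 < C ∧ ∀ (ε : ℝ), 0 < ε → ∀ (N : ℕ) (c : Fin N → ℝ), 2 ≤ N →
      natError N c < ENNReal.ofReal ε → Real.exp ((C / ε) ^ 2) < N := by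
  obtain ⟨C, hC, hb⟩ := natError_ge_of_uniform h.2.2
  exact ⟨C, hC, fun ε hε N c hN happrox ↦ exp_lt_of_natError_lt hC hb hε hN happrox⟩

/-- Prop. 4.5 implies Prop. 4.4 as soon as `|g(n)|√n ↛ 0` — recorded as the printed mechanism:
if `naturalError n → 0` then `|g(n)|√n → 0`. [cite: BaezDuarte2000, Prop. 4.5 (proof of Prop. 4.4)] -/
theorem tendsto_moebiusHarmonic_of_tendsto (h5 : BaezDuarte2000_prop4_5)
    (hconv : Tendsto naturalError atTop (𝓝 0)) :
    Tendsto (fun n : ℕ ↦ |moebiusHarmonic n| * Real.sqrt n) atTop (𝓝 0) := by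
  obtain ⟨C, _hC, h⟩ := h5
  rw [ENNReal.tendsto_nhds_zero] at hconv
  rw [Metric.tendsto_nhds]
  intro ε hε
  have hev := hconv (ENNReal.ofReal (ε / 2)) (by simpa using half_pos hε)
  filter_upwards [hev, eventually_ge_atTop 1] with n hn hn1
  have hle := (h n hn1).trans hn
  rw [ENNReal.ofReal_le_ofReal_iff (half_pos hε).le] at hle
  have hg : |moebiusHarmonic n| * Real.sqrt n ≤ ε / 2 := (le_max_right _ _).trans hle
  have hg0 : 0 ≤ |moebiusHarmonic n| * Real.sqrt n := by positivity
  rw [Real.dist_eq, sub_zero, abs_of_nonneg hg0]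
  linarith

end Literature.Barriers.RiemannHypothesis
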